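import Mathlib.LinearAlgebra.Span.Basic
import Mathlib.LinearAlgebra.Pi
import Mathlib.Algebra.BigOperators.Pi
import Mathlib.Algebra.BigOperators.Ring.Finset
import Mathlib.Data.Fintype.BigOperators
import Mathlib.Algebra.GroupWithZero.NonZeroDivisors
import Mathlib.RingTheory.Ideal.Span
import Mathlib.RingTheory.Ideal.Operations
import Mathlib.Algebra.Module.BigOperators
import Mathlib.Tactic.Ring
import HarnessLib

/-!
# Crux `NoZenoR` (stmt-ResolutionOfSingularities-19943) — the local algebra of the contractedness step for `𝔪ⁿ`:
# on a chart where `𝔪𝒪_X = (g)` is principal, the syzygies of `(t₁, …, t_s)` with values in `(gⁿ)` are generated by the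
# GLOBAL relations `t^β (t_j ε_i − t_i ε_j)`, `|β| = n − 1` (`n ≥ 1`)

Route `ResolutionOfSingularities/HomologicalConductor` (cell decomp-res, hand leafhand-res-homologicalconduct-22 g0).
OURS: AI-written, weaker than expert review; nothing here is a statement of the manuscript under review (Hironaka 2017).
SUPPORT level, counted 0.  Def-free, fact-free, pure commutative algebra.

WHY (repair census of this hand, residual of `Lipman1969_8_1` = «`𝔪ⁿ` contracted on one desingularization
`π : X → Spec S`», see `…Lipman81Of72`, `…PowersContracted`, `…ContractedSections`).  A road to that residual which avoids
Lipman's Lemma (7.3): with generators `t₁, …, t_s` of `𝔪` and `𝓛 = 𝔪𝒪_X` invertible (Prop. (3.1)), the kernel `𝒦ₙ` of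
`Ψₙ : (𝓛ⁿ)^{⊕s} → 𝓛ⁿ⁺¹`, `(u_i) ↦ Σ t_i u_i`, is, FOR `n ≥ 1`, generated by the finitely many GLOBAL sections
`t^β (t_j ε_i − t_i ε_j)` (`|β| = n − 1`); so `𝒪_X^N ↠ 𝒦ₙ` with coherent kernel, `Ȟ¹(𝒪_X^N) = 0` (rationality) and the
tree's right-exactness of `Ȟ¹` on resolutions of surface germs (`cechMapH1_surjective_of_isResolution_of_coh`) give
`Ȟ¹(𝒦ₙ) = 0`, whence `Γ((𝓛ⁿ)^{⊕s}) ↠ Γ(𝓛ⁿ⁺¹)` and `𝔪ⁿ⁺¹` is contracted once `𝔪ⁿ` is (`Γ(X, 𝒪_X) = S`).  This file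
PROVES the local algebra behind «generated by global sections»: on an affine chart `Spec B` where `𝓛 = (g)`, `t_i = g v_i`
with `(v_i)` unimodular,

* `eq_sum_smul_koszul_of_unimodular` / `mem_span_koszul_of_unimodular` — the syzygies of a unimodular row `(v_i)`
  (`Σ w_i v_i = 1`) are generated by the Koszul relations `v_j ε_i − v_i ε_j`: explicitly
  `d = Σ_{i,j} (w_j d_i) · (v_j ε_i − v_i ε_j)` whenever `Σ v_i d_i = 0`;
* `pow_eq_sum_prod_mul_prod` — `g^m = Σ_{β : Fin m → ι} (Π_k w_{β k}) · t^β` (from `(Σ w_i t_i)^m = g^m`);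
* `mem_span_monomial_koszul` — **for `n ≥ 1`, every syzygy `(c_i) = (gⁿ d_i)` of `(t_i)` (`Σ t_i c_i = 0`) lies in the
  `B`-span of the `t^β · (t_j ε_i − t_i ε_j)`, `β : Fin (n−1) → ι`** (`g` a non-zero-divisor).

No crux, kill test or summit statement is proved here; resolution in positive characteristic is NOT proved.

References: J. Lipman, Publ. Math. IHÉS 36 (1969), Theorem (7.2), Lemma (7.3) (pp. 209–211) [`Lipman1969`]
(the statement these syzygies replace); folklore (Koszul relations of a unimodular row).
-/

-- single-problem summit: the doubled namespace component `ResolutionOfSingularities` is forced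
set_option linter.dupNamespace false

open Finset

namespace Summit.ResolutionOfSingularities.ResolutionOfSingularities.Theorems.NoZeno.QuadraticTransform

variable {B : Type*} [CommRing B] {ι : Type*} [Fintype ι] [DecidableEq ι]

/-- **Syzygies of a unimodular row are Koszul, explicitly**: if `Σ_i w_i v_i = 1` and `Σ_i v_i d_i = 0` then
`d = Σ_{(i,j)} (w_j d_i) · (v_j ε_i − v_i ε_j)`. [folklore] -/
theorem eq_sum_smul_koszul_of_unimodular (v w d : ι → B) (hw : ∑ i, w i * v i = 1) (hd : ∑ i, v i * d i = 0) :
    d = ∑ p : ι × ι, (w p.2 * d p.1) • ((Pi.single p.1 (v p.2) : ι → B) - Pi.single p.2 (v p.1)) := by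
  funext l
  simp only [Finset.sum_apply, Pi.smul_apply, Pi.sub_apply, smul_eq_mul, mul_sub, Finset.sum_sub_distrib]
  rw [Fintype.sum_prod_type, Fintype.sum_prod_type]
  -- first double sum: only `p.1 = l` contributes
  have h1 : ∑ i, ∑ j, w j * d i * (Pi.single i (v j) : ι → B) l = d l * ∑ j, w j * v j := by
    rw [Finset.mul_sum]
    rw [Finset.sum_eq_single l]
    · refine Finset.sum_congr rfl fun j _ => ?_
      rw [Pi.single_eq_same]; ring
    · intro i _ hi
      refine Finset.sum_eq_zero fun j _ => ?_
      rw [Pi.single_eq_of_ne (Ne.symm hi), mul_zero]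
    · intro h; exact absurd (Finset.mem_univ l) h
  -- second double sum: only `p.2 = l` contributes
  have h2 : ∑ i, ∑ j, w j * d i * (Pi.single j (v i) : ι → B) l = w l * ∑ i, v i * d i := by
    rw [Finset.mul_sum]
    refine Finset.sum_congr rfl fun i _ => ?_
    rw [Finset.sum_eq_single l]
    · rw [Pi.single_eq_same]; ring
    · intro j _ hj
      rw [Pi.single_eq_of_ne (Ne.symm hj), mul_zero]
    · intro h; exact absurd (Finset.mem_univ l) h
  rw [h1, h2, hw, hd, mul_one, mul_zero, sub_zero]

/-- **The syzygy module of a unimodular row is spanned by the Koszul relations.** [folklore] -/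
theorem mem_span_koszul_of_unimodular (v w d : ι → B) (hw : ∑ i, w i * v i = 1) (hd : ∑ i, v i * d i = 0) :
    d ∈ Submodule.span B (Set.range fun p : ι × ι => ((Pi.single p.1 (v p.2) : ι → B) - Pi.single p.2 (v p.1))) := by
  rw [eq_sum_smul_koszul_of_unimodular v w d hw hd]
  exact Submodule.sum_mem _ fun p _ => Submodule.smul_mem _ _ (Submodule.subset_span ⟨p, rfl⟩)

omit [DecidableEq ι] in
/-- `g^m = Σ_{β : Fin m → ι} (Π_k w_{β k}) · Π_k t_{β k}` when `t_i = g v_i` and `Σ w_i v_i = 1`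
(expand `(Σ_i w_i t_i)^m = g^m`). [folklore] -/
theorem pow_eq_sum_prod_mul_prod (g : B) (v w t : ι → B) (hw : ∑ i, w i * v i = 1) (ht : ∀ i, t i = g * v i)
    (m : ℕ) : g ^ m = ∑ β : Fin m → ι, (∏ k, w (β k)) * ∏ k, t (β k) := by
  have h1 : ∑ i, w i * t i = g := by
    calc ∑ i, w i * t i = g * ∑ i, w i * v i := by
          rw [Finset.mul_sum]; exact Finset.sum_congr rfl fun i _ => by rw [ht i]; ring
      _ = g := by rw [hw, mul_one]
  calc g ^ m = ∏ _k : Fin m, ∑ i, w i * t i := by rw [h1, Finset.prod_const, Finset.card_univ, Fintype.card_fin]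
    _ = ∑ β : Fin m → ι, ∏ k, w (β k) * t (β k) := by
        rw [Finset.prod_univ_sum, Fintype.piFinset_univ]
    _ = ∑ β : Fin m → ι, (∏ k, w (β k)) * ∏ k, t (β k) :=
        Finset.sum_congr rfl fun β _ => Finset.prod_mul_distrib

/-- **For `n ≥ 1`, syzygies of `(t_i) = (g v_i)` with values in `(gⁿ)` are generated by the global relations
`t^β · (t_j ε_i − t_i ε_j)`, `β : Fin (n−1) → ι`** (`(v_i)` unimodular, `g` a non-zero-divisor): the local algebra of
«`𝒦ₙ = ker((𝔪ⁿ𝒪_X)^{⊕s} → 𝔪ⁿ⁺¹𝒪_X)` is generated by global sections» on a chart where `𝔪𝒪_X = (g)`. [folklore] -/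
theorem mem_span_monomial_koszul (g : B) (hg : g ∈ nonZeroDivisors B) (v w t : ι → B) (hw : ∑ i, w i * v i = 1)
    (ht : ∀ i, t i = g * v i) (n : ℕ) (hn : 1 ≤ n) (d : ι → B) (hc : ∑ i, t i * (g ^ n * d i) = 0) :
    (fun i => g ^ n * d i) ∈ Submodule.span B (Set.range fun q : (Fin (n - 1) → ι) × (ι × ι) =>
      (∏ k, t (q.1 k)) • ((Pi.single q.2.1 (t q.2.2) : ι → B) - Pi.single q.2.2 (t q.2.1))) := by
  -- `Σ v_i d_i = 0` (cancel the non-zero-divisor `g^{n+1}`)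
  have hd : ∑ i, v i * d i = 0 := by
    have h1 : g ^ (n + 1) * ∑ i, v i * d i = 0 := by
      rw [← hc, Finset.mul_sum]
      exact Finset.sum_congr rfl fun i _ => by rw [ht i]; ring
    rw [mul_comm] at h1
    exact (nonZeroDivisors B).pow_mem hg (n + 1) |> fun h => (mul_right_mem_nonZeroDivisors_eq_zero_iff h).mp h1
  -- `d = Σ (w_j d_i) · K(v)_{ij}`; `gⁿ K(v)_{ij} = g^{n-1} K(t)_{ij}`; `g^{n-1} = Σ_β (Π w) t^β`
  obtain ⟨m, rfl⟩ : ∃ m, n = m + 1 := ⟨n - 1, by omega⟩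
  rw [Nat.add_sub_cancel]
  have hK : ∀ (p : ι × ι) (l : ι), g ^ (m + 1) * ((Pi.single p.1 (v p.2) - Pi.single p.2 (v p.1) : ι → B) l) =
      g ^ m * ((Pi.single p.1 (t p.2) - Pi.single p.2 (t p.1) : ι → B) l) := by
    intro p l
    simp only [Pi.sub_apply]
    rcases eq_or_ne l p.1 with h1 | h1 <;> rcases eq_or_ne l p.2 with h2 | h2
    · subst h1; rw [← h2]; simp only [Pi.single_eq_same, sub_self, mul_zero]
    · subst h1; simp only [Pi.single_eq_same, Pi.single_eq_of_ne h2, ht, sub_zero]; ring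
    · subst h2; simp only [Pi.single_eq_same, Pi.single_eq_of_ne h1, ht, zero_sub]; ring
    · simp only [Pi.single_eq_of_ne h1, Pi.single_eq_of_ne h2, sub_self, mul_zero]
  have hdec : (fun i => g ^ (m + 1) * d i) =
      ∑ p : ι × ι, (w p.2 * d p.1) • (g ^ m • ((Pi.single p.1 (t p.2) : ι → B) - Pi.single p.2 (t p.1))) := by
    funext l
    have hd' := congrFun (eq_sum_smul_koszul_of_unimodular v w d hw hd) l
    rw [hd']
    simp only [Finset.sum_apply, Pi.smul_apply, smul_eq_mul, Finset.mul_sum]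
    refine Finset.sum_congr rfl fun p _ => ?_
    rw [← hK p l]
    ring
  rw [hdec]
  refine Submodule.sum_mem _ fun p _ => Submodule.smul_mem _ _ ?_
  -- `g^m • K(t)_p = Σ_β (Π w(βk)) • (t^β • K(t)_p)`
  rw [pow_eq_sum_prod_mul_prod g v w t hw ht m, Finset.sum_smul]
  refine Submodule.sum_mem _ fun β _ => ?_
  rw [mul_smul]
  exact Submodule.smul_mem _ _ (Submodule.subset_span ⟨(β, p), rfl⟩)

omit [DecidableEq ι] in
/-- **The chart data**: if the `t_i` generate the principal ideal `(g)` of `B` with `g` a non-zero-divisor (on an affine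
chart of a desingularization where `𝔪𝒪_X = (g)` is invertible: Lipman Prop. (3.1)), then `t_i = g v_i` with `(v_i)`
UNIMODULAR, `Σ w_i v_i = 1` — the hypotheses of `mem_span_monomial_koszul`. [folklore] -/
theorem exists_unimodular_of_span_range_eq_span_singleton (g : B) (hg : g ∈ nonZeroDivisors B) (t : ι → B)
    (ht : Ideal.span (Set.range t) = Ideal.span {g}) :
    ∃ v w : ι → B, (∀ i, t i = g * v i) ∧ ∑ i, w i * v i = 1 := by
  have hti : ∀ i, ∃ v : B, t i = g * v := fun i => by
    have h : t i ∈ Ideal.span {g} := ht ▸ Ideal.subset_span ⟨i, rfl⟩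
    obtain ⟨v, hv⟩ := Ideal.mem_span_singleton'.mp h
    exact ⟨v, by rw [← hv, mul_comm]⟩
  choose v hv using hti
  have hg' : g ∈ Ideal.span (Set.range t) := ht ▸ Ideal.mem_span_singleton_self g
  obtain ⟨w, hw⟩ := Ideal.mem_span_range_iff_exists_fun.mp hg'
  refine ⟨v, w, hv, ?_⟩
  -- `g = Σ w_i t_i = g Σ w_i v_i`, cancel `g`
  have h1 : (∑ i, w i * v i - 1) * g = 0 := by
    rw [sub_mul, one_mul, Finset.sum_mul, sub_eq_zero]
    calc ∑ i, w i * v i * g = ∑ i, w i * t i := Finset.sum_congr rfl fun i _ => by rw [hv i]; ring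
      _ = g := hw
  exact sub_eq_zero.mp ((mul_right_mem_nonZeroDivisors_eq_zero_iff hg).mp h1)

end Summit.ResolutionOfSingularities.ResolutionOfSingularities.Theorems.NoZeno.QuadraticTransform
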